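import Literature.AnabelianGeometry.EtaleTheta.Discharge.Sec2MonoThetaAutLift

/-!
# [EtTh] Prop 2.14 (iii), BI-THETA case, PER AUTOMORPHISM: a bi-continuous automorphism of `Π^tp_X`
# under which the theta cocycle is invariant up to a coboundary lifts to an automorphism of the model
# bi-theta environment `B(η)` (proof-only companion)

Mochizuki, *The Étale Theta Function and its Frobenioid-theoretic Manifestations* [EtTh], Publ. RIMS 45
(2009), §2, Prop 2.14 (iii) pp.49–50 (locators `p.N` = PDF pages of the PRIMS text; bib key
`MochizukiEtTh2009`). PROOF-ONLY companion (no `def`) of `MonoThetaEnv.lean` (`ThetaEnvData.modelBi`,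
Def 2.13 (iii)) and `ThetaRigidity.lean` (`RigidData.Prop214_iii_bi`) — seat abc-iut-L2-t2, §2 owner;
continues `Discharge/Sec2MonoThetaAutLift.lean` (the MONO lift per automorphism, abc-iut-L2-t2 g4) and
`Discharge/Sec2NondiscretenessProofs.lean` (`ThetaEnvTower.exists_biIso_conjX`, the `N·(l·ℤ)`-translations).

PRINT (Prop 2.14 (iii), proof, p.50): "In the bi-theta case, we observe that if, in the situation of
assertion (ii), `t^Θ_Ÿ` is obtained as an `N·(l·ℤ)`-conjugate of `s^Θ_Ÿ`, then the cocycle `δ` is a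
coboundary; in particular, [in this case] the automorphism `α_δ` preserves the `μ_N`-conjugacy classes of
subgroups determined by the images of `s^Θ_Ÿ`, `t^Θ_Ÿ`, `s^alg_Ÿ`. This shows that
`Im_N ⊇ (N·l·ℤ) ⋊ {±1}`."

THE MECHANISM, typed once for ALL automorphisms (translations AND the inversion): let `φ` be a
bi-continuous automorphism of `Π^tp_X` with `φ(Π^tp_Y) = Π^tp_Y`, `φ(Π^tp_Ÿ) = Π^tp_Ÿ`, `φ(Δ_X) = Δ_X`,
`χ(aug(φ x)) = χ(aug x)`, and `ψ ∈ Aut(μ_N)`.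
* `ThetaEnvData.exists_modelBiIso_of_aut` — Def 2.13 (iii) iso constructor: a bi-continuous automorphism
  normalising `D_Y`, permuting `μ_N`, and carrying `Im(s^Θ_η)` resp. `Im(s^alg)` onto `μ_N`-conjugates of
  `Im(s^Θ_{η'})` resp. `Im(s^alg)` underlies an isomorphism `B(η) ≃ B(η')`.
* **`ThetaEnvData.exists_biIso_over_aut`** — if the `(ψ, φ)`-transform of `η` is `η` UP TO A COBOUNDARY,
  `ψ(η d) = η(φ d) · ∂m(φ d)` on `Π^tp_Ÿ` (`m ∈ μ_N`; the cocycle `δ` of the text is a coboundary), then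
  `A₀ : (a, g) ↦ (ψ a, φ g)` IS an automorphism of the model BI-theta environment `B(η) = (Π^tp_Y[μ_N], D_Y,
  [Im s^Θ_η], [Im s^alg])` inducing `φ` on `Π^tp_Y` and `ψ` on `μ_N`: it normalises `D_Y` (shape lemmas of
  abc-iut-L2-t10's `Sec2AutOverProofs.lean`), carries `Im(s^Θ_η)` onto its conjugate by `m⁻¹ ∈ μ_N` and
  `Im(s^alg)` onto itself. No Cor 2.18 (ii) input: unlike the mono case the hypothesis is exact invariance up
  to a coboundary, not invariance of the collection up to a `K^×`-twist (a Kummer shift by a non-trivial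
  class does not preserve `[Im s^alg]`).
* `…_of_comp_symm_eq` (`ψ = 1`, `m = 1`: `η ∘ φ⁻¹ = η` on the nose) — the shape of the `{±1}`-part: by
  Prop 1.4 (ii) p.22 ("`Θ̈(Ü) = −Θ̈(Ü⁻¹)`; `Θ̈(−Ü) = −Θ̈(Ü)`") one of the two lifts of the inversion to `Ÿ`
  fixes `Θ̈` exactly, and the inversion acts by `+1` on `Δ_Θ` (Prop 2.2 (i), p.37);
  `…_of_augConj` (`φ` covering an inner automorphism of `G_K`, e.g. a restriction of conjugation by
  `Π^tp_C`); `RigidData.exists_biIso_over_aut` (+ `_of_comp_symm_eq`) with `χ`-invariance from the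
  Cor 2.18 (i) clauses for THIS `φ` (abc-iut-L2-t10's `chi_aug_invariant`).
The converse (every automorphism of `B(η)` over `φ` has this shape on `η`) is
`Discharge/Sec2BiThetaAutCriterion.lean`. HONEST FRAMING: [EtTh] is refereed; OUR kernel checks over the
typed §2 interface; the cusp-LABEL clause `RigidData.ActsOnCuspsBy` is not addressed (label equivariance
is interface input); no side is taken on [IUTchIII] Cor 3.12; typed ≠ discharged elsewhere.
-/

namespace Literature.AnabelianGeometry.EtaleTheta

universe u

namespace ThetaEnvData

variable {N : ℕ+} (T : ThetaEnvData.{u} N)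

/-- **Def 2.13 (iii) iso constructor for bi-theta environments**: a bi-continuous automorphism `c` of
`Π^tp_Y[μ_N]` whose class normalises `D_Y`, which maps `μ_N` onto itself, carries `Im(s^Θ_η)` onto a
`μ_N`-conjugate of `Im(s^Θ_{η'})` and `Im(s^alg_Ÿ)` onto a `μ_N`-conjugate of itself, underlies an
isomorphism of model bi-theta environments `B(η) ≃ B(η')`. [cite: MochizukiEtTh2009, Def 2.13(iii) p.48] -/
theorem exists_modelBiIso_of_aut {η η' : T.PiYdd → T.mu} (hη : η ∈ T.thetaCocycles)
    (hη' : η' ∈ T.thetaCocycles) (c : contMulAut T.env)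
    (hD : T.DY.map (MulAut.conj (TopOut.mk _ c)).toMonoidHom = T.DY)
    (hμ : ∀ a, ∃ b, (c : MulAut T.env) (CycEnvelope.inMu T.augY T.chi a) =
      CycEnvelope.inMu T.augY T.chi b)
    (hμ' : ∀ b, ∃ a, (c : MulAut T.env) (CycEnvelope.inMu T.augY T.chi a) =
      CycEnvelope.inMu T.augY T.chi b) (m : T.mu)
    (hs : (T.sTheta hη).range.map (c : MulAut T.env).toMonoidHom =
      (T.sTheta hη').range.map (MulAut.conj (CycEnvelope.inMu T.augY T.chi m)).toMonoidHom)
    (m' : T.mu)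
    (ha : T.sAlg.range.map (c : MulAut T.env).toMonoidHom =
      T.sAlg.range.map (MulAut.conj (CycEnvelope.inMu T.augY T.chi m')).toMonoidHom) :
    ∃ α : (T.modelBi hη).Iso (T.modelBi hη'), ∀ x, α.e x = (c : MulAut T.env) x := by
  refine ⟨{ e := ContinuousMulEquiv.mk (c : MulAut T.env) c.2.1 c.2.2
            map_D := ?_
            map_sTheta := ?_
            map_sAlg := ?_ }, fun x => rfl⟩
  · change T.DY.map _ = T.DY
    rw [TopOut.transport_mk_eq_conj]
    exact hD
  · change (fun H : Subgroup T.env => H.map (c : MulAut T.env).toMonoidHom) ''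
        CycEnvelope.muConjClass T.augY T.chi (T.sTheta hη).range =
      CycEnvelope.muConjClass T.augY T.chi (T.sTheta hη').range
    rw [CycEnvelope.image_muConjClass_eq_of_perm T.augY T.chi _ hμ hμ', hs,
      CycEnvelope.muConjClass_map_conj_inMu]
  · change (fun H : Subgroup T.env => H.map (c : MulAut T.env).toMonoidHom) ''
        CycEnvelope.muConjClass T.augY T.chi T.sAlg.range =
      CycEnvelope.muConjClass T.augY T.chi T.sAlg.range
    rw [CycEnvelope.image_muConjClass_eq_of_perm T.augY T.chi _ hμ hμ', ha,
      CycEnvelope.muConjClass_map_conj_inMu]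

/-- The two presentations of the coboundary of `m ∈ μ_N` on `Π^tp_Ÿ` differ by inversion:
`(∂m(d))⁻¹ = ∂(m⁻¹)(d)` (`μ_N` is commutative). [cite: MochizukiEtTh2009, Def 2.13 p.47] -/
theorem coboundary_inv_apply (m : T.mu) (d : T.PiYdd) :
    (CycEnvelope.coboundary (T.aug.comp T.PiYdd.subtype) T.chi m d)⁻¹ =
      CycEnvelope.coboundary T.augY T.chi m⁻¹ (T.inclYdd d) := by
  change (m * (T.chi (T.aug (d : T.PiX)) m)⁻¹)⁻¹ = m⁻¹ * (T.chi (T.aug (d : T.PiX)) m⁻¹)⁻¹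
  rw [mul_inv_rev, inv_inv, map_inv, inv_inv, mul_comm]

/-- **Prop 2.14 (iii), BI-theta case, existence, PER AUTOMORPHISM.** Let `φ` be a bi-continuous
automorphism of `Π^tp_X` with `φ(Π^tp_Y) = Π^tp_Y`, `φ(Π^tp_Ÿ) = Π^tp_Ÿ`, `φ(Δ_X) = Δ_X` and
`χ(aug(φ x)) = χ(aug x)`; let `ψ ∈ Aut(μ_N)`, and suppose the `(ψ, φ)`-transform of the theta cocycle `η`
is `η` up to the coboundary of some `m ∈ μ_N`: `ψ(η d) = η(φ d) · ∂m(φ d)` on `Π^tp_Ÿ` ("the cocycle `δ` is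
a coboundary", p.50). Then `(a, g) ↦ (ψ a, φ g)` is an automorphism of the model BI-theta environment
`B(η) = (Π^tp_Y[μ_N], D_Y, [Im s^Θ_η], [Im s^alg_Ÿ])` (Def 2.13 (iii)) inducing `φ` on `Π^tp_Y`.
[cite: MochizukiEtTh2009, Prop 2.14(iii) p.50] -/
theorem exists_biIso_over_aut {η : T.PiYdd → T.mu} (hη : η ∈ T.thetaCocycles)
    (φ : T.PiX ≃ₜ* T.PiX) (hY : T.PiY.map φ.toMulEquiv.toMonoidHom = T.PiY)
    (hdd : T.PiYdd.map φ.toMulEquiv.toMonoidHom = T.PiYdd)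
    (hker : T.aug.ker.map φ.toMulEquiv.toMonoidHom = T.aug.ker)
    (hχ : ∀ x : T.PiX, T.chi (T.aug (φ x)) = T.chi (T.aug x))
    (ψ : T.mu ≃* T.mu) (m : T.mu)
    (hηm : ∀ d d' : T.PiYdd, φ (d : T.PiX) = d' →
      ψ (η d) = η d' * CycEnvelope.coboundary (T.aug.comp T.PiYdd.subtype) T.chi m d') :
    ∃ α : (T.modelBi hη).Iso (T.modelBi hη),
      (∀ x, ((CycEnvelope.proj T.augY T.chi (α.e x) : T.PiY) : T.PiX) =
        φ (CycEnvelope.proj T.augY T.chi x : T.PiY)) ∧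
      ∀ a, α.e (CycEnvelope.inMu T.augY T.chi a) = CycEnvelope.inMu T.augY T.chi (ψ a) := by
  -- adapted from abc-iut-L2-t10's `RigidData.cor218_iv_surjective_of` / this seat's g4
  -- `exists_monoIso_over_aut`: here the automorphism `A₀` itself does the job (no Kummer shift).
  have hψ : ∀ σ a, ψ (T.chi σ a) = T.chi σ (ψ a) := T.mulEquiv_comm_chi ψ
  have hψ' : ∀ σ a, ψ.symm (T.chi σ a) = T.chi σ (ψ.symm a) := T.mulEquiv_comm_chi ψ.symm
  have hχ' : ∀ x : T.PiX, T.chi (T.aug (φ.symm x)) = T.chi (T.aug x) := fun x => by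
    rw [← hχ (φ.symm x), ContinuousMulEquiv.apply_symm_apply]
  obtain ⟨hYm, hYm'⟩ := T.mem_and_symm_mem_of_map_eq φ _ hY
  obtain ⟨hddm, hddm'⟩ := T.mem_and_symm_mem_of_map_eq φ _ hdd
  obtain ⟨hkerm, hkerm'⟩ := T.mem_and_symm_mem_of_map_eq φ _ hker
  -- the automorphism `A₀ : (a, g) ↦ (ψ a, φ g)`
  let A₀ : MulAut T.env :=
    { toFun := fun x => ⟨ψ x.left, ⟨φ (x.right : T.PiX), hYm _ x.right.2⟩⟩
      invFun := fun x => ⟨ψ.symm x.left, ⟨φ.symm (x.right : T.PiX), hYm' _ x.right.2⟩⟩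
      left_inv := fun x => by ext <;> simp
      right_inv := fun x => by ext <;> simp
      map_mul' := fun x y => by
        ext
        · simp only [SemidirectProduct.mul_left, map_mul, MonoidHom.coe_comp,
            Function.comp_apply, Subgroup.coe_subtype]
          rw [hψ, hχ]
        · simp }
  have hl : ∀ x : T.env, (A₀ x).left = ψ x.left := fun x => rfl
  have hr : ∀ x : T.env, (((A₀ x).right : T.PiY) : T.PiX) = φ (x.right : T.PiX) := fun x => rfl
  -- continuity of `A₀`
  have hlc : Continuous fun x : T.env => x.left :=
    (continuous_fst.comp continuous_induced_dom :
      Continuous (Prod.fst ∘ fun x : T.env => (x.left, x.right)))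
  have hrc : Continuous fun x : T.env => ((x.right : T.PiY) : T.PiX) :=
    continuous_subtype_val.comp (continuous_snd.comp continuous_induced_dom :
      Continuous (Prod.snd ∘ fun x : T.env => (x.left, x.right)))
  have hA₀c : A₀ ∈ contMulAut T.env := by
    refine ⟨?_, ?_⟩
    · refine continuous_induced_rng.2 ?_
      change Continuous fun x : T.env =>
        ((ψ x.left, (⟨φ (x.right : T.PiX), hYm _ x.right.2⟩ : T.PiY)) : T.mu × T.PiY)
      exact ((continuous_of_discreteTopology (f := fun a : T.mu => ψ a)).comp hlc).prodMk
        ((φ.continuous.comp hrc).subtype_mk _)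
    · refine continuous_induced_rng.2 ?_
      change Continuous fun x : T.env =>
        ((ψ.symm x.left, (⟨φ.symm (x.right : T.PiX), hYm' _ x.right.2⟩ : T.PiY)) : T.mu × T.PiY)
      exact ((continuous_of_discreteTopology (f := fun a : T.mu => ψ.symm a)).comp hlc).prodMk
        ((φ.symm.continuous.comp hrc).subtype_mk _)
  set cA : contMulAut T.env := ⟨A₀, hA₀c⟩ with hcA
  -- `τ`, `τ'`: the maps induced by `φ⁻¹`, `φ` on `G_K`
  obtain ⟨τ, hτ⟩ := T.exists_augMap_of_ker_stable φ.symm hkerm'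
  obtain ⟨τ', hτ'⟩ := T.exists_augMap_of_ker_stable φ hkerm
  -- `A₀` normalises `D_Y`
  obtain ⟨hl', hr'⟩ := ThetaEnvData.inv_shape cA φ ψ hl hr
  have h1 := ThetaEnvData.DY_conj_gen_of_shape cA φ ψ hl hr hψ hχ τ hτ
  have h2' := ThetaEnvData.DY_conj_gen_of_shape cA⁻¹ φ.symm ψ.symm hl' hr' hψ' hχ' τ'
    (fun g => by rw [ContinuousMulEquiv.symm_symm]; exact hτ' g)
  have hD : T.DY.map (MulAut.conj (TopOut.mk _ cA)).toMonoidHom = T.DY := by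
    refine T.DY_map_conj_eq_of_generators cA h1 fun d hd => ?_
    have h := h2' d hd
    rwa [map_inv, inv_inv] at h
  -- action on `μ_N`
  have hAμ : ∀ a, A₀ (CycEnvelope.inMu T.augY T.chi a) = CycEnvelope.inMu T.augY T.chi (ψ a) :=
    fun a => by
    ext
    · rfl
    · change φ ((1 : T.PiY) : T.PiX) = ((1 : T.PiY) : T.PiX); rw [Subgroup.coe_one, map_one]
  have hμ : ∀ a, ∃ b, (cA : MulAut T.env) (CycEnvelope.inMu T.augY T.chi a) =
      CycEnvelope.inMu T.augY T.chi b := fun a => ⟨ψ a, hAμ a⟩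
  have hμ' : ∀ b, ∃ a, (cA : MulAut T.env) (CycEnvelope.inMu T.augY T.chi a) =
      CycEnvelope.inMu T.augY T.chi b := fun b =>
    ⟨ψ.symm b, by change A₀ _ = _; rw [hAμ, MulEquiv.apply_symm_apply]⟩
  -- action on `Im(s^Θ_η)`: `A₀(s^Θ_η(d)) = inMu(m)⁻¹ · s^Θ_η(φ d) · inMu(m)`
  have hst : ∀ d : T.PiYdd, A₀ (T.sTheta hη d) =
      MulAut.conj (CycEnvelope.inMu T.augY T.chi m⁻¹) (T.sTheta hη ⟨φ (d : T.PiX), hddm _ d.2⟩) := by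
    intro d
    have hd := hηm d ⟨φ (d : T.PiX), hddm _ d.2⟩ rfl
    rw [CycEnvelope.conj_inMu_eq_shift_coboundary, CycEnvelope.shift_apply]
    ext
    · change ψ (η d)⁻¹ = (η _)⁻¹ * CycEnvelope.coboundary T.augY T.chi m⁻¹ (T.inclYdd _)
      rw [map_inv, hd, mul_inv, T.coboundary_inv_apply]
    · rfl
  have hs : (T.sTheta hη).range.map (cA : MulAut T.env).toMonoidHom =
      (T.sTheta hη).range.map (MulAut.conj (CycEnvelope.inMu T.augY T.chi m⁻¹)).toMonoidHom := by
    ext y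
    constructor
    · rintro ⟨_, ⟨d, rfl⟩, rfl⟩
      exact ⟨_, ⟨⟨φ (d : T.PiX), hddm _ d.2⟩, rfl⟩, (hst d).symm⟩
    · rintro ⟨_, ⟨d', rfl⟩, rfl⟩
      refine ⟨_, ⟨⟨φ.symm (d' : T.PiX), hddm' _ d'.2⟩, rfl⟩, ?_⟩
      change A₀ _ = MulAut.conj (CycEnvelope.inMu T.augY T.chi m⁻¹) (T.sTheta hη d')
      rw [hst]
      congr 2
      apply Subtype.ext
      exact ContinuousMulEquiv.apply_symm_apply φ (d' : T.PiX)
  -- action on `Im(s^alg_Ÿ)`: `A₀(s^alg(d)) = s^alg(φ d)`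
  have hsa : ∀ d : T.PiYdd, A₀ (T.sAlg d) = T.sAlg ⟨φ (d : T.PiX), hddm _ d.2⟩ := by
    intro d
    ext
    · exact map_one ψ
    · rfl
  have ha : T.sAlg.range.map (cA : MulAut T.env).toMonoidHom =
      T.sAlg.range.map (MulAut.conj (CycEnvelope.inMu T.augY T.chi 1)).toMonoidHom := by
    rw [map_one, map_one]
    ext y
    constructor
    · rintro ⟨_, ⟨d, rfl⟩, rfl⟩
      exact ⟨_, ⟨⟨φ (d : T.PiX), hddm _ d.2⟩, rfl⟩, (hsa d).symm⟩
    · rintro ⟨_, ⟨d', rfl⟩, rfl⟩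
      refine ⟨_, ⟨⟨φ.symm (d' : T.PiX), hddm' _ d'.2⟩, rfl⟩, ?_⟩
      change A₀ _ = T.sAlg d'
      rw [hsa]
      congr 1
      apply Subtype.ext
      exact ContinuousMulEquiv.apply_symm_apply φ (d' : T.PiX)
  obtain ⟨α, hα⟩ := T.exists_modelBiIso_of_aut hη hη cA hD hμ hμ' m⁻¹ hs 1 ha
  exact ⟨α, fun x => by rw [hα]; exact hr x, fun a => by rw [hα]; exact hAμ a⟩

/-- **The exactly-untwisted case** (`ψ = 1`, no coboundary): if `η ∘ φ⁻¹ = η` ON THE NOSE on `Π^tp_Ÿ`,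
then `(a, g) ↦ (a, φ g)` is an automorphism of the model bi-theta environment `B(η)` over `φ`. The shape
of the `{±1}`-part of Prop 2.14 (iii): one of the two lifts of the inversion to `Ÿ` fixes `Θ̈` exactly
("`Θ̈(Ü⁻¹) = −Θ̈(Ü)`", "`Θ̈(−Ü) = −Θ̈(Ü)`", Prop 1.4 (ii) p.22, so `Θ̈(−Ü⁻¹) = Θ̈(Ü)`), and acts by `+1` on
`Δ_Θ` (Prop 2.2 (i), p.37). [cite: MochizukiEtTh2009, Prop 2.14(iii) p.50] -/
theorem exists_biIso_over_aut_of_comp_symm_eq {η : T.PiYdd → T.mu} (hη : η ∈ T.thetaCocycles)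
    (φ : T.PiX ≃ₜ* T.PiX) (hY : T.PiY.map φ.toMulEquiv.toMonoidHom = T.PiY)
    (hdd : T.PiYdd.map φ.toMulEquiv.toMonoidHom = T.PiYdd)
    (hker : T.aug.ker.map φ.toMulEquiv.toMonoidHom = T.aug.ker)
    (hχ : ∀ x : T.PiX, T.chi (T.aug (φ x)) = T.chi (T.aug x))
    (heq : ∀ d : T.PiYdd, η ⟨φ.symm (d : T.PiX),
      (T.mem_and_symm_mem_of_map_eq φ _ hdd).2 _ d.2⟩ = η d) :
    ∃ α : (T.modelBi hη).Iso (T.modelBi hη),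
      (∀ x, ((CycEnvelope.proj T.augY T.chi (α.e x) : T.PiY) : T.PiX) =
        φ (CycEnvelope.proj T.augY T.chi x : T.PiY)) ∧
      ∀ a, α.e (CycEnvelope.inMu T.augY T.chi a) = CycEnvelope.inMu T.augY T.chi a := by
  have hηm : ∀ d d' : T.PiYdd, φ (d : T.PiX) = d' → (MulEquiv.refl T.mu) (η d) =
      η d' * CycEnvelope.coboundary (T.aug.comp T.PiYdd.subtype) T.chi (1 : T.mu) d' := by
    intro d d' hdd'
    have hd : (⟨φ.symm (d' : T.PiX), (T.mem_and_symm_mem_of_map_eq φ _ hdd).2 _ d'.2⟩ : T.PiYdd) =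
        d := by
      apply Subtype.ext
      change φ.symm (d' : T.PiX) = (d : T.PiX)
      rw [← hdd', ContinuousMulEquiv.symm_apply_apply]
    have h1 : CycEnvelope.coboundary (T.aug.comp T.PiYdd.subtype) T.chi (1 : T.mu) d' = 1 := by
      change (1 : T.mu) * (T.chi (T.aug (d' : T.PiX)) 1)⁻¹ = 1
      rw [map_one, inv_one, mul_one]
    rw [MulEquiv.refl_apply, h1, mul_one, ← heq d', hd]
  obtain ⟨α, hα, hαμ⟩ := T.exists_biIso_over_aut hη φ hY hdd hker hχ (MulEquiv.refl _) 1 hηm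
  exact ⟨α, hα, fun a => by rw [hαμ, MulEquiv.refl_apply]⟩

/-- **Variant: `φ` covers an inner automorphism of `G_K`** (`aug (φ x) = g₀ · aug x · g₀⁻¹` — e.g. `φ` is
the restriction to `Π^tp_X` of conjugation by an element of `Π^tp_C`, the inversion of `C = X/{±1}`): then
`φ(Δ_X) = Δ_X` and `χ(aug(φ x)) = χ(aug x)` hold automatically (`Aut(μ_N)` is commutative).
[cite: MochizukiEtTh2009, Prop 2.14(iii) p.50] -/
theorem exists_biIso_over_aut_of_augConj {η : T.PiYdd → T.mu} (hη : η ∈ T.thetaCocycles)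
    (φ : T.PiX ≃ₜ* T.PiX) (hY : T.PiY.map φ.toMulEquiv.toMonoidHom = T.PiY)
    (hdd : T.PiYdd.map φ.toMulEquiv.toMonoidHom = T.PiYdd)
    (g₀ : T.G) (haug : ∀ x : T.PiX, T.aug (φ x) = g₀ * T.aug x * g₀⁻¹)
    (ψ : T.mu ≃* T.mu) (m : T.mu)
    (hηm : ∀ d d' : T.PiYdd, φ (d : T.PiX) = d' →
      ψ (η d) = η d' * CycEnvelope.coboundary (T.aug.comp T.PiYdd.subtype) T.chi m d') :
    ∃ α : (T.modelBi hη).Iso (T.modelBi hη),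
      (∀ x, ((CycEnvelope.proj T.augY T.chi (α.e x) : T.PiY) : T.PiX) =
        φ (CycEnvelope.proj T.augY T.chi x : T.PiY)) ∧
      ∀ a, α.e (CycEnvelope.inMu T.augY T.chi a) = CycEnvelope.inMu T.augY T.chi (ψ a) := by
  -- as in this seat's g4 `exists_monoIso_over_aut_of_augConj`
  have haug' : ∀ x : T.PiX, T.aug (φ.symm x) = g₀⁻¹ * T.aug x * g₀ := fun x => by
    have h := haug (φ.symm x)
    rw [ContinuousMulEquiv.apply_symm_apply] at h
    rw [h]; group
  have hker : T.aug.ker.map φ.toMulEquiv.toMonoidHom = T.aug.ker := by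
    ext k
    constructor
    · rintro ⟨k₀, hk₀, rfl⟩
      have hk₀' : T.aug k₀ = 1 := hk₀
      change T.aug (φ k₀) = 1
      rw [haug, hk₀', mul_one, mul_inv_cancel]
    · intro hk
      have hk' : T.aug k = 1 := hk
      refine ⟨φ.symm k, ?_, φ.apply_symm_apply k⟩
      change T.aug (φ.symm k) = 1
      rw [haug', hk', mul_one, inv_mul_cancel]
  have hχ : ∀ x : T.PiX, T.chi (T.aug (φ x)) = T.chi (T.aug x) := fun x => by
    rw [haug, map_mul, map_mul, map_inv]
    apply MulEquiv.ext
    intro a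
    rw [MulAut.mul_apply, MulAut.mul_apply, T.mulEquiv_comm_chi (T.chi g₀) (T.aug x)]
    congr 1
    rw [← MulAut.mul_apply, mul_inv_cancel, MulAut.one_apply]
  exact T.exists_biIso_over_aut hη φ hY hdd hker hχ ψ m hηm

end ThetaEnvData

namespace RigidData

variable {N : ℕ+} {l : ℕ} (R : RigidData.{u} N l)

/-- **Prop 2.14 (iii) BI case, per automorphism, over `RigidData`**: the `χ`-invariance is supplied by
the Cor 2.18 (i) clauses for THIS `φ` — `φ` preserves `Ker(Π^tp_X ↠ (Π^tp_X)^Θ)` and `l·Δ_Θ`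
(abc-iut-L2-t10's `chi_aug_invariant`); exact invariance of `η` up to a coboundary then gives an
automorphism of the model bi-theta environment `B(η)` over `φ`.
[cite: MochizukiEtTh2009, Prop 2.14(iii) p.50] -/
theorem exists_biIso_over_aut {η : R.PiYdd → R.mu} (hη : η ∈ R.thetaCocycles)
    (φ : R.PiX ≃ₜ* R.PiX) (hY : R.PiY.map φ.toMulEquiv.toMonoidHom = R.PiY)
    (hdd : R.PiYdd.map φ.toMulEquiv.toMonoidHom = R.PiYdd)
    (hker : R.aug.ker.map φ.toMulEquiv.toMonoidHom = R.aug.ker)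
    (hK : R.thetaKer.map φ.toMulEquiv.toMonoidHom = R.thetaKer)
    (hL : R.lDeltaTheta.map φ.toMulEquiv.toMonoidHom = R.lDeltaTheta)
    (ψ : R.mu ≃* R.mu) (m : R.mu)
    (hηm : ∀ d d' : R.PiYdd, φ (d : R.PiX) = d' →
      ψ (η d) = η d' * CycEnvelope.coboundary (R.aug.comp R.PiYdd.subtype) R.chi m d') :
    ∃ α : (R.modelBi hη).Iso (R.modelBi hη),
      (∀ x, ((CycEnvelope.proj R.augY R.chi (α.e x) : R.PiY) : R.PiX) =
        φ (CycEnvelope.proj R.augY R.chi x : R.PiY)) ∧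
      ∀ a, α.e (CycEnvelope.inMu R.augY R.chi a) = CycEnvelope.inMu R.augY R.chi (ψ a) :=
  R.toThetaEnvData.exists_biIso_over_aut hη φ hY hdd hker (R.chi_aug_invariant φ hK hL) ψ m hηm

/-- **The exactly-untwisted case over `RigidData`** (`η ∘ φ⁻¹ = η` on `Π^tp_Ÿ`; the `{±1}`-shape).
[cite: MochizukiEtTh2009, Prop 2.14(iii) p.50] -/
theorem exists_biIso_over_aut_of_comp_symm_eq {η : R.PiYdd → R.mu} (hη : η ∈ R.thetaCocycles)
    (φ : R.PiX ≃ₜ* R.PiX) (hY : R.PiY.map φ.toMulEquiv.toMonoidHom = R.PiY)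
    (hdd : R.PiYdd.map φ.toMulEquiv.toMonoidHom = R.PiYdd)
    (hker : R.aug.ker.map φ.toMulEquiv.toMonoidHom = R.aug.ker)
    (hK : R.thetaKer.map φ.toMulEquiv.toMonoidHom = R.thetaKer)
    (hL : R.lDeltaTheta.map φ.toMulEquiv.toMonoidHom = R.lDeltaTheta)
    (heq : ∀ d : R.PiYdd, η ⟨φ.symm (d : R.PiX),
      (R.toThetaEnvData.mem_and_symm_mem_of_map_eq φ _ hdd).2 _ d.2⟩ = η d) :
    ∃ α : (R.modelBi hη).Iso (R.modelBi hη),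
      (∀ x, ((CycEnvelope.proj R.augY R.chi (α.e x) : R.PiY) : R.PiX) =
        φ (CycEnvelope.proj R.augY R.chi x : R.PiY)) ∧
      ∀ a, α.e (CycEnvelope.inMu R.augY R.chi a) = CycEnvelope.inMu R.augY R.chi a :=
  R.toThetaEnvData.exists_biIso_over_aut_of_comp_symm_eq hη φ hY hdd hker (R.chi_aug_invariant φ hK hL)
    heq

end RigidData

end Literature.AnabelianGeometry.EtaleTheta
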